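import Mathlib
import Summits.Ventures.HodgeRepro.Tier4.Line4.PlacePart
import Summits.Ventures.HodgeRepro.Tier4.Line4.FinitePlacePositivity
import Summits.Ventures.HodgeRepro.Tier4.Line4.LevelIndexBound
import Summits.Ventures.HodgeRepro.Tier4.Line4.LevelIndicator

/-!
# Tier4/Line4/LevelSplit — the level subgroup and the level double coset split along a set `S` of finite places; along
`p^n` the away-from-`p` factor is the level-one double coset (C-L4-PSPLIT, Part B.2)

Blind re-derivation cell `pub-hodge-repro`, Tier 4 «prove the step» (README §9–§10), seat t4-L2-p1 (gen 3; plan-4 g5's cut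
C-L4-PSPLIT S15510 (2), statement S15526).  Tree path `lean/Summits/Ventures/HodgeRepro/Tier4/Line4/LevelSplit.lean`.
Imports `Line4/PlacePart` (the parts `GA.ofPlacesPart` / `GA.offPlacesPart`, `supportedOn`, `trivialOn`),
`Line4/FinitePlacePositivity` (`levelDoubleCoset`), `Line4/LevelIndexBound` (`natSize_pow_eq_one_of_not_mem`),
`Line4/LevelIndicator` (`levelDC`).  Three definitions (`placesAbove k p`, `levelDCAt`, `levelDCAway`); no literature.

* `mem_levelK_iff_forall` — for `g ∈ G(𝔸_f)`, `g ∈ K(N)` is the PLACEWISE condition `|(g − 1)_{ij}|_w ≤ |N|_w` and the same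
  for `g⁻¹`, at every finite place `w` (`mem_levelK`, `congrSet`, `modSet` unfolded; the archimedean clause is automatic on
  `G(𝔸_f)`, `infPart_entry_sub_one_eq_zero`).
* **`mem_levelK_iff_parts`**: `g ∈ K(N) ↔ g_S ∈ K(N) ∧ g^{(S)} ∈ K(N)` — `K(N) = K(N)_S × K(N)^{(S)}`.
* **`mem_levelDoubleCoset_iff_parts`**: `g ∈ K(N) γ K(N) ↔ g_S ∈ K(N) γ_S K(N) ∧ g^{(S)} ∈ K(N) γ^{(S)} K(N)` (`g, γ ∈ G(𝔸_f)`):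
  the double coset is the product of its `S`-part and its away part (elements supported on `S` commute with elements trivial
  on `S`, `commute_of_mem_supportedOn_of_mem_trivialOn`).
* `placesAbove k p := {v : (p : 𝓞 k) ∈ v.asIdeal}`; **`mem_levelK_pow_iff_of_mem_trivialOn`**: an element of `G(𝔸_f)` trivial
  on the places above `p` lies in `K(p^n)` iff it lies in `K(1)` (`|p^n|_w = 1` off `p`, `natSize_pow_eq_one_of_not_mem`;
  nothing to check at the places above `p`); **`mem_levelDoubleCoset_pow_iff_of_mem_trivialOn`**: the same for the double
  coset `K(p^n) γ K(p^n)` at a `γ` trivial on the places above `p` — THE AWAY-FROM-`p` FACTOR IS `n`-FREE (F-L4-PHASE-PPOWER,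
  L4-p1 S15478, in the form the line consumes).
* **`levelDC_eq_mul`** (S15510 (2)): the level indicator `levelDC γ₀ N x` (LevelIndicator) is the product of its `S`-factor
  `levelDCAt S γ₀ N x := 1[(x_f)_S ∈ K(N) (γ₀,f)_S K(N)]` and its away factor `levelDCAway S γ₀ N x := 1[(x_f)^{(S)} ∈ K(N)
  (γ₀,f)^{(S)} K(N)]`; **`levelDCAway_pow_eq`**: along `p^n` with `S = placesAbove p` the away factor equals its level-one
  value — INDEPENDENT OF `n`.
  (The support set and the support measure split the same way — `Line4/SuppMeasureSplit`.)

Nothing here says anything about the status of the Hodge conjecture for CM abelian varieties, which is NOT proved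
(HC_CM is NOT proved by anyone in this repository).
-/

set_option autoImplicit false
noncomputable section
namespace Summit.Ventures.HodgeRepro.Tier4.Line4
open Summit.Ventures.HodgeRepro.Tier4 Summit.Ventures.HodgeRepro.Tier4.Common
  Summit.Ventures.HodgeRepro.Tier4.Line1 NumberField IsDedekindDomain Matrix
open scoped NumberField Classical Pointwise

section Placewise
variable {k : Type} [Field k] [NumberField k] (W : PlaneData k)

/-- For `g ∈ G(𝔸_f)`, the congruence `g ≡ 1 (mod N)` is the placewise condition `|(g − 1)_{ij}|_w ≤ |N|_w`. -/
theorem isCongr_iff_forall_of_mem_finitePart {g : GA W} (hg : g ∈ finitePart W) (N : ℕ) :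
    IsCongr k N (GA.mat W g) ↔ ∀ (i j : Fin 4) (w : HeightOneSpectrum (𝓞 k)),
      Valued.v ((finM k (GA.mat W g) i j - (1 : M4f k) i j) w) ≤ natSize k w N := by
  have hfin : ∀ i j, finPart k ((GA.mat W g - 1) i j) = finM k (GA.mat W g) i j - (1 : M4f k) i j := by
    intro i j
    show finM k (GA.mat W g - 1) i j = _
    rw [finM_sub, finM_one, Matrix.sub_apply]
  constructor
  · intro h i j w
    have := (h i j).2
    rw [hfin] at this
    exact this w
  · intro h i j
    refine ⟨infPart_entry_sub_one_eq_zero W hg i j, ?_⟩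
    rw [hfin]
    exact fun w => h i j w

/-- For `g ∈ G(𝔸_f)`: `g ∈ K(N)` iff the placewise congruences hold for `g` and for `g⁻¹`. -/
theorem mem_levelK_iff_forall {g : GA W} (hg : g ∈ finitePart W) (N : ℕ) :
    g ∈ levelK W N ↔
      (∀ (i j : Fin 4) (w : HeightOneSpectrum (𝓞 k)),
        Valued.v ((finM k (GA.mat W g) i j - (1 : M4f k) i j) w) ≤ natSize k w N) ∧
      (∀ (i j : Fin 4) (w : HeightOneSpectrum (𝓞 k)),
        Valued.v ((finM k (GA.mat W g⁻¹) i j - (1 : M4f k) i j) w) ≤ natSize k w N) := by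
  rw [mem_levelK, isCongr_iff_forall_of_mem_finitePart W hg, isCongr_iff_forall_of_mem_finitePart W (inv_mem hg)]

end Placewise

section Split
variable {k : Type} [Field k] [NumberField k] (W : PlaneData k) (S : Set (HeightOneSpectrum (𝓞 k)))

/-- The `w`-component of `(g_S − 1)_{ij}`: that of `(g − 1)_{ij}` on `S`, `0` elsewhere. -/
theorem finM_ofPlacesPart_sub_one_apply (g : GA W) (i j : Fin 4) (w : HeightOneSpectrum (𝓞 k)) :
    (finM k (GA.mat W (GA.ofPlacesPart W S g)) i j - (1 : M4f k) i j) w =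
      if w ∈ S then (finM k (GA.mat W g) i j - (1 : M4f k) i j) w else 0 := by
  rw [fa_sub_apply, fa_sub_apply, GA.mat_ofPlacesPart, finM_mixM, atFinMS_apply_apply]
  split_ifs <;> simp

/-- The `w`-component of `(g^{(S)} − 1)_{ij}`: `0` on `S`, that of `(g − 1)_{ij}` elsewhere. -/
theorem finM_offPlacesPart_sub_one_apply (g : GA W) (i j : Fin 4) (w : HeightOneSpectrum (𝓞 k)) :
    (finM k (GA.mat W (GA.offPlacesPart W S g)) i j - (1 : M4f k) i j) w =
      if w ∈ S then 0 else (finM k (GA.mat W g) i j - (1 : M4f k) i j) w := by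
  rw [fa_sub_apply, fa_sub_apply, GA.mat_offPlacesPart, finM_mixM, awayFinMS_apply_apply]
  split_ifs <;> simp

/-- **`K(N) = K(N)_S × K(N)^{(S)}`**: for `g ∈ G(𝔸_f)`, `g ∈ K(N) ↔ g_S ∈ K(N) ∧ g^{(S)} ∈ K(N)`. -/
theorem mem_levelK_iff_parts {g : GA W} (hg : g ∈ finitePart W) (N : ℕ) :
    g ∈ levelK W N ↔ GA.ofPlacesPart W S g ∈ levelK W N ∧ GA.offPlacesPart W S g ∈ levelK W N := by
  rw [mem_levelK_iff_forall W hg, mem_levelK_iff_forall W (ofPlacesPart_mem_finitePart W S g),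
    mem_levelK_iff_forall W (offPlacesPart_mem_finitePart W S g), ← ofPlacesPart_inv, ← offPlacesPart_inv]
  simp only [finM_ofPlacesPart_sub_one_apply, finM_offPlacesPart_sub_one_apply]
  constructor
  · rintro ⟨h1, h2⟩
    refine ⟨⟨fun i j w => ?_, fun i j w => ?_⟩, ⟨fun i j w => ?_, fun i j w => ?_⟩⟩ <;> split_ifs
    · exact h1 i j w
    · simp
    · exact h2 i j w
    · simp
    · simp
    · exact h1 i j w
    · simp
    · exact h2 i j w
  · rintro ⟨⟨h1, h2⟩, ⟨h3, h4⟩⟩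
    refine ⟨fun i j w => ?_, fun i j w => ?_⟩
    · by_cases hw : w ∈ S
      · have := h1 i j w; rwa [if_pos hw] at this
      · have := h3 i j w; rwa [if_neg hw] at this
    · by_cases hw : w ∈ S
      · have := h2 i j w; rwa [if_pos hw] at this
      · have := h4 i j w; rwa [if_neg hw] at this

/-- The `S`-part of an element of `K(N)` lies in `K(N)`. -/
theorem ofPlacesPart_mem_levelK {g : GA W} {N : ℕ} (hg : g ∈ levelK W N) : GA.ofPlacesPart W S g ∈ levelK W N :=
  ((mem_levelK_iff_parts W S (levelK_le_finitePart W N hg) N).1 hg).1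

/-- The away part of an element of `K(N)` lies in `K(N)`. -/
theorem offPlacesPart_mem_levelK {g : GA W} {N : ℕ} (hg : g ∈ levelK W N) : GA.offPlacesPart W S g ∈ levelK W N :=
  ((mem_levelK_iff_parts W S (levelK_le_finitePart W N hg) N).1 hg).2

/-- The `S`-part of an element of the double coset lies in the double coset of the `S`-part. -/
theorem ofPlacesPart_mem_levelDoubleCoset {g γ : GA W} {N : ℕ} (hg : g ∈ levelDoubleCoset W N γ) :
    GA.ofPlacesPart W S g ∈ levelDoubleCoset W N (GA.ofPlacesPart W S γ) := by
  obtain ⟨a, ha, c, hc, rfl⟩ := exists_eq_mul_of_mem_mul_singleton_mul W _ _ _ hg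
  rw [ofPlacesPart_mul, ofPlacesPart_mul]
  exact Set.mul_mem_mul (Set.mul_mem_mul (ofPlacesPart_mem_levelK W S ha) (Set.mem_singleton _))
    (ofPlacesPart_mem_levelK W S hc)

/-- The away part of an element of the double coset lies in the double coset of the away part. -/
theorem offPlacesPart_mem_levelDoubleCoset {g γ : GA W} {N : ℕ} (hg : g ∈ levelDoubleCoset W N γ) :
    GA.offPlacesPart W S g ∈ levelDoubleCoset W N (GA.offPlacesPart W S γ) := by
  obtain ⟨a, ha, c, hc, rfl⟩ := exists_eq_mul_of_mem_mul_singleton_mul W _ _ _ hg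
  rw [offPlacesPart_mul, offPlacesPart_mul]
  exact Set.mul_mem_mul (Set.mul_mem_mul (offPlacesPart_mem_levelK W S ha) (Set.mem_singleton _))
    (offPlacesPart_mem_levelK W S hc)

/-- **`K(N) γ K(N) = (K(N) γ_S K(N)) × (K(N) γ^{(S)} K(N))`**: for `g, γ ∈ G(𝔸_f)`,
`g ∈ K(N) γ K(N) ↔ g_S ∈ K(N) γ_S K(N) ∧ g^{(S)} ∈ K(N) γ^{(S)} K(N)`. -/
theorem mem_levelDoubleCoset_iff_parts {g γ : GA W} (hg : g ∈ finitePart W) (hγ : γ ∈ finitePart W) (N : ℕ) :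
    g ∈ levelDoubleCoset W N γ ↔
      GA.ofPlacesPart W S g ∈ levelDoubleCoset W N (GA.ofPlacesPart W S γ) ∧
        GA.offPlacesPart W S g ∈ levelDoubleCoset W N (GA.offPlacesPart W S γ) := by
  constructor
  · intro h
    exact ⟨ofPlacesPart_mem_levelDoubleCoset W S h, offPlacesPart_mem_levelDoubleCoset W S h⟩
  · rintro ⟨h1, h2⟩
    obtain ⟨a, ha, c, hc, hac⟩ := exists_eq_mul_of_mem_mul_singleton_mul W _ _ _ h1
    obtain ⟨a', ha', c', hc', hac'⟩ := exists_eq_mul_of_mem_mul_singleton_mul W _ _ _ h2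
    -- normalise the representatives: `S`-parts on the `S` side, away parts on the away side
    have hS : GA.ofPlacesPart W S g = GA.ofPlacesPart W S a * GA.ofPlacesPart W S γ * GA.ofPlacesPart W S c := by
      have := congrArg (GA.ofPlacesPart W S) hac
      rwa [ofPlacesPart_eq_self_of_mem_supportedOn W S (ofPlacesPart_mem_supportedOn W S g), ofPlacesPart_mul,
        ofPlacesPart_mul, ofPlacesPart_eq_self_of_mem_supportedOn W S (ofPlacesPart_mem_supportedOn W S γ)] at this
    have hA : GA.offPlacesPart W S g = GA.offPlacesPart W S a' * GA.offPlacesPart W S γ * GA.offPlacesPart W S c' := by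
      have := congrArg (GA.offPlacesPart W S) hac'
      rwa [offPlacesPart_eq_self_of_mem_trivialOn W S (offPlacesPart_mem_finitePart W S g)
        (offPlacesPart_mem_trivialOn W S g), offPlacesPart_mul, offPlacesPart_mul,
        offPlacesPart_eq_self_of_mem_trivialOn W S (offPlacesPart_mem_finitePart W S γ)
        (offPlacesPart_mem_trivialOn W S γ)] at this
    have haS := ofPlacesPart_mem_levelK W S ha
    have hcS := ofPlacesPart_mem_levelK W S hc
    have haA := offPlacesPart_mem_levelK W S ha'
    have hcA := offPlacesPart_mem_levelK W S hc'
    -- commutations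
    have hcomm1 : GA.ofPlacesPart W S c * GA.offPlacesPart W S a' = GA.offPlacesPart W S a' * GA.ofPlacesPart W S c :=
      commute_of_mem_supportedOn_of_mem_trivialOn W S (ofPlacesPart_mem_supportedOn W S c)
        (offPlacesPart_mem_trivialOn W S a') (offPlacesPart_mem_finitePart W S a')
    have hcomm2 : GA.ofPlacesPart W S γ * GA.offPlacesPart W S a' = GA.offPlacesPart W S a' * GA.ofPlacesPart W S γ :=
      commute_of_mem_supportedOn_of_mem_trivialOn W S (ofPlacesPart_mem_supportedOn W S γ)
        (offPlacesPart_mem_trivialOn W S a') (offPlacesPart_mem_finitePart W S a')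
    have hcomm3 : GA.ofPlacesPart W S c * GA.offPlacesPart W S γ = GA.offPlacesPart W S γ * GA.ofPlacesPart W S c :=
      commute_of_mem_supportedOn_of_mem_trivialOn W S (ofPlacesPart_mem_supportedOn W S c)
        (offPlacesPart_mem_trivialOn W S γ) (offPlacesPart_mem_finitePart W S γ)
    have hgeq : g = (GA.ofPlacesPart W S a * GA.offPlacesPart W S a') * γ *
        (GA.ofPlacesPart W S c * GA.offPlacesPart W S c') := by
      calc g = GA.ofPlacesPart W S g * GA.offPlacesPart W S g := (ofPlacesPart_mul_offPlacesPart_of_mem W S hg).symm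
        _ = (GA.ofPlacesPart W S a * GA.ofPlacesPart W S γ * GA.ofPlacesPart W S c) *
              (GA.offPlacesPart W S a' * GA.offPlacesPart W S γ * GA.offPlacesPart W S c') := by rw [hS, hA]
        _ = GA.ofPlacesPart W S a * GA.ofPlacesPart W S γ * (GA.ofPlacesPart W S c * GA.offPlacesPart W S a') *
              GA.offPlacesPart W S γ * GA.offPlacesPart W S c' := by simp only [mul_assoc]
        _ = GA.ofPlacesPart W S a * (GA.ofPlacesPart W S γ * GA.offPlacesPart W S a') *
              (GA.ofPlacesPart W S c * GA.offPlacesPart W S γ) * GA.offPlacesPart W S c' := by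
            rw [hcomm1]; simp only [mul_assoc]
        _ = GA.ofPlacesPart W S a * GA.offPlacesPart W S a' *
              (GA.ofPlacesPart W S γ * GA.offPlacesPart W S γ) *
              (GA.ofPlacesPart W S c * GA.offPlacesPart W S c') := by
            rw [hcomm2, hcomm3]; simp only [mul_assoc]
        _ = (GA.ofPlacesPart W S a * GA.offPlacesPart W S a') * γ *
              (GA.ofPlacesPart W S c * GA.offPlacesPart W S c') := by
            rw [ofPlacesPart_mul_offPlacesPart_of_mem W S hγ]
    rw [hgeq]
    exact Set.mul_mem_mul (Set.mul_mem_mul (mul_mem haS haA) (Set.mem_singleton _)) (mul_mem hcS hcA)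

end Split

section Prime
variable {k : Type} [Field k] [NumberField k] (W : PlaneData k)

/-- **The places of `k` above a rational prime `p`**: `{v : (p : 𝓞 k) ∈ v.asIdeal}` (`|p|_v < 1`,
`natSize_lt_one_iff_mem`).  The split of record for the level sequence `p^n` is along this set. -/
def placesAbove (p : ℕ) : Set (HeightOneSpectrum (𝓞 k)) := {v | (p : 𝓞 k) ∈ v.asIdeal}

omit [NumberField k] in
/-- Membership in `placesAbove`. -/
theorem mem_placesAbove (p : ℕ) (v : HeightOneSpectrum (𝓞 k)) : v ∈ placesAbove (k := k) p ↔ (p : 𝓞 k) ∈ v.asIdeal :=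
  Iff.rfl

/-- **THE LEVEL IS TRIVIAL AWAY FROM `p`**: an element of `G(𝔸_f)` trivial at the places above `p` lies in `K(p^n)` iff it
lies in `K(1)`. -/
theorem mem_levelK_pow_iff_of_mem_trivialOn {g : GA W} (hg : g ∈ finitePart W) {p : ℕ}
    (ht : g ∈ trivialOn W (placesAbove (k := k) p)) (n : ℕ) : g ∈ levelK W (p ^ n) ↔ g ∈ levelK W 1 := by
  have key : ∀ {h : GA W}, h ∈ finitePart W → h ∈ trivialOn W (placesAbove (k := k) p) → ∀ (i j : Fin 4)
      (w : HeightOneSpectrum (𝓞 k)), Valued.v ((finM k (GA.mat W h) i j - (1 : M4f k) i j) w) ≤ natSize k w (p ^ n) ↔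
        Valued.v ((finM k (GA.mat W h) i j - (1 : M4f k) i j) w) ≤ natSize k w 1 := by
    intro h _ ht i j w
    by_cases hw : w ∈ placesAbove (k := k) p
    · have h0 : (finM k (GA.mat W h) i j - (1 : M4f k) i j) w = 0 := by
        rw [fa_sub_apply, finM_apply_apply_of_mem_trivialOn W _ ht hw i j, sub_self]
      rw [h0, Valuation.map_zero]
      exact ⟨fun _ => zero_le, fun _ => zero_le⟩
    · rw [natSize_pow_eq_one_of_not_mem w p n hw, natSize_one]
  rw [mem_levelK_iff_forall W hg, mem_levelK_iff_forall W hg]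
  simp only [key hg ht, key (inv_mem hg) ((trivialOn W _).inv_mem ht)]

/-- **THE AWAY-FROM-`p` DOUBLE COSET IS `n`-FREE**: for `g, γ ∈ G(𝔸_f)` trivial at the places above `p`,
`g ∈ K(p^n) γ K(p^n) ↔ g ∈ K(1) γ K(1)`. -/
theorem mem_levelDoubleCoset_pow_iff_of_mem_trivialOn {g γ : GA W} (hg : g ∈ finitePart W) (hγ : γ ∈ finitePart W)
    {p : ℕ} (hgt : g ∈ trivialOn W (placesAbove (k := k) p)) (hγt : γ ∈ trivialOn W (placesAbove (k := k) p)) (n : ℕ) :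
    g ∈ levelDoubleCoset W (p ^ n) γ ↔ g ∈ levelDoubleCoset W 1 γ := by
  constructor
  · exact fun h => levelDoubleCoset_antitone W (one_dvd _) γ h
  · intro h
    obtain ⟨a, ha, c, hc, hac⟩ := exists_eq_mul_of_mem_mul_singleton_mul W _ _ _ h
    have hg' : g = GA.offPlacesPart W (placesAbove (k := k) p) a * γ * GA.offPlacesPart W (placesAbove (k := k) p) c := by
      have := congrArg (GA.offPlacesPart W (placesAbove (k := k) p)) hac
      rwa [offPlacesPart_eq_self_of_mem_trivialOn W _ hg hgt, offPlacesPart_mul, offPlacesPart_mul,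
        offPlacesPart_eq_self_of_mem_trivialOn W _ hγ hγt] at this
    have ha' : GA.offPlacesPart W (placesAbove (k := k) p) a ∈ levelK W (p ^ n) :=
      (mem_levelK_pow_iff_of_mem_trivialOn W (offPlacesPart_mem_finitePart W _ a)
        (offPlacesPart_mem_trivialOn W _ a) n).2 (offPlacesPart_mem_levelK W _ ha)
    have hc' : GA.offPlacesPart W (placesAbove (k := k) p) c ∈ levelK W (p ^ n) :=
      (mem_levelK_pow_iff_of_mem_trivialOn W (offPlacesPart_mem_finitePart W _ c)
        (offPlacesPart_mem_trivialOn W _ c) n).2 (offPlacesPart_mem_levelK W _ hc)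
    rw [hg']
    exact Set.mul_mem_mul (Set.mul_mem_mul ha' (Set.mem_singleton _)) hc'

end Prime

section Indicator
variable {k : Type} [Field k] [NumberField k] (W : PlaneData k) (S : Set (HeightOneSpectrum (𝓞 k))) (γ₀ : GA W) (N : ℕ)

/-- **The `S`-factor of the level indicator**: `1` iff `(x_f)_S ∈ K(N) (γ₀,f)_S K(N)`. -/
def levelDCAt (x : GA W) : ℂ :=
  (levelDoubleCoset W N (GA.ofPlacesPart W S (GA.ofFinPart W γ₀))).indicator (fun _ => (1 : ℂ))
    (GA.ofPlacesPart W S (GA.ofFinPart W x))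

/-- **The away-from-`S` factor of the level indicator**: `1` iff `(x_f)^{(S)} ∈ K(N) (γ₀,f)^{(S)} K(N)`. -/
def levelDCAway (x : GA W) : ℂ :=
  (levelDoubleCoset W N (GA.offPlacesPart W S (GA.ofFinPart W γ₀))).indicator (fun _ => (1 : ℂ))
    (GA.offPlacesPart W S (GA.ofFinPart W x))

/-- **THE LEVEL INDICATOR FACTORS ALONG THE `S`-SPLIT**: `levelDC γ₀ N x = levelDCAt S γ₀ N x · levelDCAway S γ₀ N x`. -/
theorem levelDC_eq_mul (x : GA W) : levelDC W γ₀ N x = levelDCAt W S γ₀ N x * levelDCAway W S γ₀ N x := by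
  unfold levelDC levelDCAt levelDCAway
  have h := mem_levelDoubleCoset_iff_parts W S (ofFinPart_mem_finitePart' W x) (ofFinPart_mem_finitePart' W γ₀) N
  by_cases hx : GA.ofFinPart W x ∈ levelDoubleCoset W N (GA.ofFinPart W γ₀)
  · obtain ⟨h1, h2⟩ := h.1 hx
    rw [Set.indicator_of_mem hx, Set.indicator_of_mem h1, Set.indicator_of_mem h2, mul_one]
  · rw [Set.indicator_of_notMem hx]
    by_cases h1 : GA.ofPlacesPart W S (GA.ofFinPart W x) ∈ levelDoubleCoset W N (GA.ofPlacesPart W S (GA.ofFinPart W γ₀))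
    · have h2 : GA.offPlacesPart W S (GA.ofFinPart W x) ∉
          levelDoubleCoset W N (GA.offPlacesPart W S (GA.ofFinPart W γ₀)) := fun h2 => hx (h.2 ⟨h1, h2⟩)
      rw [Set.indicator_of_notMem h2, mul_zero]
    · rw [Set.indicator_of_notMem h1, zero_mul]

/-- **THE AWAY FACTOR IS `n`-FREE ALONG `p^n`**: with `S = placesAbove p`, `levelDCAway S γ₀ (p^n) x = levelDCAway S γ₀ 1 x`. -/
theorem levelDCAway_pow_eq (p n : ℕ) (x : GA W) :
    levelDCAway W (placesAbove (k := k) p) γ₀ (p ^ n) x = levelDCAway W (placesAbove (k := k) p) γ₀ 1 x := by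
  unfold levelDCAway
  have h := mem_levelDoubleCoset_pow_iff_of_mem_trivialOn W
    (offPlacesPart_mem_finitePart W (placesAbove (k := k) p) (GA.ofFinPart W x))
    (offPlacesPart_mem_finitePart W (placesAbove (k := k) p) (GA.ofFinPart W γ₀))
    (offPlacesPart_mem_trivialOn W (placesAbove (k := k) p) (GA.ofFinPart W x))
    (offPlacesPart_mem_trivialOn W (placesAbove (k := k) p) (GA.ofFinPart W γ₀)) n
  by_cases hx : GA.offPlacesPart W (placesAbove (k := k) p) (GA.ofFinPart W x) ∈
      levelDoubleCoset W (p ^ n) (GA.offPlacesPart W (placesAbove (k := k) p) (GA.ofFinPart W γ₀))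
  · rw [Set.indicator_of_mem hx, Set.indicator_of_mem (h.1 hx)]
  · rw [Set.indicator_of_notMem hx, Set.indicator_of_notMem (fun h1 => hx (h.2 h1))]

end Indicator


end Summit.Ventures.HodgeRepro.Tier4.Line4

end
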